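import Literature.Barriers.CriticalPhenomena.PlaquetteWalkHoleRootRootNotchEast
import HarnessLib

/-!
# Barrier catalogue (SAWScalingLimit): THE ROOT NOTCH WITH ONE LIVE RAY COLUMN — `rootS` absent and at most one crossable
column on the bottom line of the root row east of the root plaquette ⇒ the under route is EMPTY

Leaf of `PlaquetteWalkHoleRootRootNotchEast` (the case of NO live column beyond `rootE`: `ΩG.WE_eq_excursionWinding_of_under_rootS_east`)
and of `PlaquetteWalkHoleRootPrefixLoop` (the prefix loop `C`, `windC`, one winding number along the excursion polygon, the jump
across the root edge). Setting: root plaquette `w` rooted at `W`, hole `holeFaceW w ∉ D`, far cell `farW w`, `rootS w = (w.1, w.2 − 1)`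
absent; the eastern ray of the hole = the bottom sides `slant x w.2`, `x ≥ w.1`, of the root row.

§1 ★★★★ `ΩG.false_of_under_excursion_ray_oneLiveColumn` — THE THIRD PREFIX-LOOP SEPARATION: `ω` a class-`B2a` UNDER-walk whose
excursion polygon exits some slot through the ray edge of column `x₁ ≥ w.1 + 1`, while `rootS w ∉ D` and every column
`w.1 + 1 ≤ x < x₁` of the ray is DEAD (`(x, w.2) ∉ D ∨ (x, w.2 − 1) ∉ D`) ⇒ `False`: `J` passes through the far cell's top midpoint
(joined to the upper corner of the root edge along the top sides of the far cell and the hole) and through the midpoint of that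
ray edge (joined to the LOWER corner along the bottom sides of the columns `x₁, x₁ − 1, …, w.1` — the first is the excursion's
own mid-edge, the others are dead doors, `w.S` included since `rootS` is absent: none is a prefix mid-edge); one winding number of
`C` along `J` against `ΩG.windC_jump`.
§2 ★★★★★ `ΩG.WE_eq_excursionWinding_of_under_rootS_oneLiveColumn` — **`rootS` ABSENT AND AT MOST ONE LIVE RAY COLUMN `x₁` EAST OF
THE ROOT PLAQUETTE ⇒ NO WOUND UNDER-WALK** (the parity law puts an odd number of excursion crossings on the ray; dead columns
and `w.S` carry none, so one of them is in column `x₁`; §1). Generalises `…_of_under_rootS_east` (all columns `≥ w.1 + 2` dead: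
take `x₁ = w.1 + 1`). Row-mirror twin `…_of_over_rootN_oneLiveColumn`.
§3 Boxes: ★★★★★ `lawL_box_rootS_rootEcol_not_wound_under` — the root plaquette's eastern neighbour in the SECOND-TO-LAST column
(`h.1 + 4 = m`), `rootS` removed AND the ray's first column killed (`rootE = (h.1 + 2, h.2)` or `pocketSE = (h.1 + 2, h.2 − 1)`
removed) ⇒ no wound under-walk, whatever else `S` removes (the lane's kit j300087: `{rootE, rootS}`, `{pocketSE, rootS}` under
witnesses TIMEOUT in `[0,6]×[−1,5]` while every other ring + near pair is FOUND — decided: NONE); twin for `rootN` with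
`rootE` / `pocketNE`.

Not in print; venture lane «pcv-sawmu», seat b-step0 gen 28 (kit j300087 «ringnear»).

References: A. Glazman, I. Manolescu, arXiv:1708.00395v3, §1 (Fig. 1, Fig. 2, remark after eq. (1)), §2.1, §4.2, Lemma 2.1
[GlazmanManolescu2019]; A. Glazman, Electron. Commun. Probab. 20 (2015) no. 86, Lemma 3.1, proof pp. 6–7
[Glazman2015WeightedSAW]; R. Courant, H. Robbins, *What is Mathematics?* (1941/1958), Ch. V Appendix §2 (the even–odd
rule) [CourantRobbins1958]; L. V. Ahlfors, *Complex Analysis*, 3rd ed. (1979), Ch. 4 §2.1 [AhlforsCA1979].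
-/

noncomputable section

open Set Function Complex
open Literature.Topology.PlaneTopology

namespace Literature.Probability.RandomPlanarGeometry.SAW.YangBaxter

open Real
open Literature.Barriers.CriticalPhenomena.PlaquetteWalk (mirrorRowFace)

open private len_eq side_jOut segment_pJ_even toC_midPt_side_mem_sideSeg
  from Literature.Probability.RandomPlanarGeometry.YangBaxterSAWExcursionJordan

open private toC_midPt_mem_crossSeg not_mem_sideSeg_N_of_mem_fSeg_hSeg not_mem_sideSeg_S_of_mem_fSeg_hSeg
  from Literature.Barriers.CriticalPhenomena.PlaquetteWalkHoleRootPrefixLoop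

namespace ΩG

variable {D : Set Face} {w : Face} {ω : ΩG D (w.side .W) (farW w)}

/-! ## §1 The third prefix-loop separation: one live ray column -/

/-- ★★★★ **THE THIRD PREFIX-LOOP SEPARATION LEMMA.** Hole and `rootS w` absent; `x₁ ≥ w.1 + 1` a column such that every ray
column strictly between the root plaquette and `x₁` is dead (`(x, w.2) ∉ D ∨ (x, w.2 − 1) ∉ D` for `w.1 + 1 ≤ x < x₁`); `ω` a
class-`B2a` UNDER-walk (first side `S`). Then no slot of the excursion polygon exits through the ray edge `slant x₁ w.2`.
[cite: CourantRobbins1958, Ch. V Appendix §2 (The Jordan Curve Theorem for Polygons: the even–odd rule)]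
[cite: AhlforsCA1979, Ch. 4 §2.1 (index of a point with respect to a closed curve)]
[cite: Glazman2015WeightedSAW, Lemma 3.1 (proof, pp. 6–7: the classes of walks through a rhombus)] -/
theorem false_of_under_excursion_ray_oneLiveColumn (hh : holeFaceW w ∉ D) (hr : RootedFace D (w.side .W) (farW w))
    (h : ω.IsB2a) (hS : ω.2.firstSideG = .S) (hRS : rootS w ∉ D) {x₁ : ℤ} (hx₁ : w.1 + 1 ≤ x₁)
    (hdead : ∀ x : ℤ, w.1 + 1 ≤ x → x < x₁ → (x, w.2) ∉ D ∨ (x, w.2 - 1) ∉ D)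
    (hJ : ∃ j, j < ω.Mv ∧ (ω.jFace h j).side (ω.jOut hr h j) = MidEdge.slant x₁ w.2) : False := by
  have hM := ω.three_le_Mv hr h
  have hF := ω.fh_lt h
  have h1 := ω.one_le_firstHitG_far
  have hlen : ω.2.arcs.length = ω.2.firstHitG + ω.Mv := len_eq h
  set F := ω.2.firstHitG with hFdef
  set n := ω.2.arcs.length with hndef
  have hnthF : ω.2.nth F = (farW w).side .S := by rw [hFdef, ω.2.nth_firstHitG, hS]
  obtain ⟨j, hj, hje⟩ := hJ
  -- no prefix mid-edge is a ray edge of a column `≤ x₁`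
  have hpre : ∀ i, 1 ≤ i → i ≤ F → ∀ x : ℤ, w.1 ≤ x → x ≤ x₁ → ω.2.nth i ≠ MidEdge.slant x w.2 := by
    intro i hi1 hiF x hxw hxx e
    have hd := ω.2.door_nth (j := i) (by omega) (by omega)
    rw [e] at hd
    simp only [MidEdge.faces] at hd
    rcases lt_trichotomy x x₁ with hl | hex | hg
    · rcases eq_or_lt_of_le hxw with hw | hw
      · apply hRS
        have ers : rootS w = (x, w.2 - 1) := by rw [← hw]; rfl
        rw [ers]; exact hd.1
      · rcases hdead x (by omega) hl with hx | hx
        · exact hx hd.2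
        · exact hx hd.1
    · subst hex
      rw [← hje, side_jOut (hr := hr) h hj] at e
      have := ω.2.nth_inj (by omega) (by omega) e
      omega
    · omega
  -- the auxiliary points
  set q1 : ℂ := toC ((holeFaceW w).base + Side.N.endA) with hq1
  set mN : ℂ := toC (midPt ((farW w).side .N)) with hmN
  set mE : ℂ := toC (midPt (MidEdge.slant x₁ w.2)) with hmE
  -- P1: the top side of the hole
  have hP1 : segment ℝ (cHi w) q1 = sideSeg (holeFaceW w) .N := by
    rw [segment_symm, sideSeg, cHi]
    congr 2
    obtain ⟨a, b⟩ := w; simp [holeFaceW, Face.base, Side.endB]; ring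
  have w1 : ω.windC (cHi w) = ω.windC q1 := by
    refine windC_eq_of_segment fun z hz k hk hzk => ?_
    rw [hP1] at hz
    obtain ⟨i, hi1, hiF, e⟩ := exists_nth_eq_of_mem_pCedge_sideSeg hh h hS hk hzk hz
      (fun q hq => not_mem_sideSeg_N_of_mem_fSeg_hSeg (by simp [holeFaceW]) hq)
    have hd := ω.2.door_nth (j := i) (by omega) (by omega)
    rw [e] at hd
    have : ((holeFaceW w).side .N).faces.1 = holeFaceW w := by
      obtain ⟨a, b⟩ := w; simp [holeFaceW, Face.side, MidEdge.faces]
    rw [this] at hd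
    exact hh hd.1
  -- P2: the right half of the top side of the far cell
  have hP2 : segment ℝ q1 mN ⊆ sideSeg (farW w) .N := by
    refine (convex_segment _ _).segment_subset ?_ (toC_midPt_side_mem_sideSeg _ _)
    have e : q1 = toC ((farW w).base + Side.N.endB) := by
      rw [hq1]; congr 1; obtain ⟨a, b⟩ := w; simp [holeFaceW, farW, Face.base, Side.endA, Side.endB]; ring
    rw [e]; exact right_mem_segment _ _ _
  have w2 : ω.windC q1 = ω.windC mN := by
    refine windC_eq_of_segment fun z hz k hk hzk => ?_
    obtain ⟨i, hi1, hiF, e⟩ := exists_nth_eq_of_mem_pCedge_sideSeg hh h hS hk hzk (hP2 hz)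
      (fun q hq => not_mem_sideSeg_N_of_mem_fSeg_hSeg (by simp [farW]) hq)
    have hle := firstHitG_le_of_nth_eq (ω := ω) (by omega) e
    have ei : i = F := by omega
    rw [ei, hnthF] at e
    exact absurd (Face.side_injective (farW w) e) (by decide)
  -- P3: the bottom sides of the columns `w.1, …, x₁ - 1`, corner to corner
  let P : ℕ → ℂ := fun k => toC (Face.base ((w.1 + (k : ℤ), w.2) : Face) + Side.S.endA)
  have hP0 : P 0 = cLo w := by
    show toC (Face.base ((w.1 + ((0 : ℕ) : ℤ), w.2) : Face) + Side.S.endA) = cLo w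
    rw [cLo]; congr 1; obtain ⟨a, b⟩ := w; simp [Face.base, Side.endA]
  have hPseg : ∀ k : ℕ, segment ℝ (P k) (P (k + 1)) = sideSeg ((w.1 + k, w.2) : Face) .S := by
    intro k
    show segment ℝ (toC (Face.base ((w.1 + (k : ℤ), w.2) : Face) + Side.S.endA))
      (toC (Face.base ((w.1 + ((k + 1 : ℕ) : ℤ), w.2) : Face) + Side.S.endA)) = sideSeg ((w.1 + k, w.2) : Face) .S
    rw [sideSeg]
    congr 2
    refine Prod.ext ?_ ?_
    · simp [Face.base, Side.endA, Side.endB]; ring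
    · simp [Face.base, Side.endA, Side.endB]
  have w3 : ∀ k : ℕ, (k : ℤ) ≤ x₁ - w.1 → ω.windC (P k) = ω.windC (cLo w) := by
    intro k
    induction k with
    | zero => intro _; rw [hP0]
    | succ k ih =>
      intro hk
      rw [← ih (by push_cast at hk ⊢; omega)]
      symm
      refine windC_eq_of_segment fun z hz k' hk' hzk => ?_
      rw [hPseg k] at hz
      obtain ⟨i, hi1, hiF, e⟩ := exists_nth_eq_of_mem_pCedge_sideSeg hh h hS hk' hzk hz
        (fun q hq => not_mem_sideSeg_S_of_mem_fSeg_hSeg (by simp) (by simp) hq)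
      exact hpre i hi1 hiF (w.1 + k) (by omega) (by push_cast at hk; omega) e
  -- P4: the left half of the bottom side of column `x₁`
  set K : ℕ := (x₁ - w.1).toNat with hKdef
  have hK : (K : ℤ) = x₁ - w.1 := by rw [hKdef]; omega
  have hPK : P K = toC (Face.base ((x₁, w.2) : Face) + Side.S.endA) := by
    show toC (Face.base ((w.1 + (K : ℤ), w.2) : Face) + Side.S.endA) = _
    rw [hK, add_sub_cancel]
  have hP4 : segment ℝ (P K) mE ⊆ sideSeg ((x₁, w.2) : Face) .S := by
    rw [hPK]
    refine (convex_segment _ _).segment_subset (left_mem_segment _ _ _) ?_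
    have e : MidEdge.slant x₁ w.2 = Face.side ((x₁, w.2) : Face) .S := rfl
    rw [hmE, e]
    exact toC_midPt_side_mem_sideSeg _ _
  have w4 : ω.windC (P K) = ω.windC mE := by
    refine windC_eq_of_segment fun z hz k hk hzk => ?_
    obtain ⟨i, hi1, hiF, e⟩ := exists_nth_eq_of_mem_pCedge_sideSeg hh h hS hk hzk (hP4 hz)
      (fun q hq => not_mem_sideSeg_S_of_mem_fSeg_hSeg (by simp) (by simp; omega) hq)
    exact hpre i hi1 hiF x₁ (by omega) le_rfl e
  -- the two midpoints lie on `J`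
  obtain ⟨j₀, hj₀, hj₀e⟩ := exists_jOut_eq_farW_N hh hr h hS
  have wN : ω.windC mN = ω.windC (ω.pJ hr h 0) := by
    refine windC_pJ_edge hh hr h hS (k := 2 * j₀) (by omega) ?_
    rw [segment_pJ_even h hj₀, hj₀e]
    exact toC_midPt_mem_crossSeg _
  have wE : ω.windC mE = ω.windC (ω.pJ hr h 0) := by
    refine windC_pJ_edge hh hr h hS (k := 2 * j) (by omega) ?_
    rw [segment_pJ_even h hj, hje]
    exact toC_midPt_mem_crossSeg _
  have := windC_jump hh h hS
  rw [w1, w2, wN, ← wE, ← w4, w3 K (by omega), sub_self] at this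
  exact zero_ne_one this

/-! ## §2 `rootS` absent and at most one live ray column ⇒ no wound under-walk -/

/-- ★★★★ **The excursion polygon of an under-walk does not wind around the root when `rootS` is absent and at most one ray column
east of the root plaquette is alive.** The parity law gives an odd number of excursion crossings of the eastern ray; a crossed
mid-edge has both faces present, so every crossing lies in column `x₁`; §1.
[cite: CourantRobbins1958, Ch. V Appendix §2 (the even–odd rule)] [cite: AhlforsCA1979, Ch. 4 §2.1 (index of a point)]
[cite: Glazman2015WeightedSAW, Lemma 3.1 (proof, pp. 6–7)] -/
theorem AJ_root_eq_zero_of_under_rootS_oneLiveColumn (hh : holeFaceW w ∉ D) (hRS : rootS w ∉ D) {x₁ : ℤ} (hx₁ : w.1 + 1 ≤ x₁)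
    (hray : ∀ x : ℤ, w.1 + 1 ≤ x → x ≠ x₁ → (x, w.2) ∉ D ∨ (x, w.2 - 1) ∉ D)
    (ω : ΩG D (w.side .W) (farW w)) (hr : RootedFace D (w.side .W) (farW w)) (h : ω.IsB2a)
    (hS : ω.2.firstSideG = .S) : ω.AJ hr h (toC (midPt (w.side .W))) = 0 := by
  classical
  have hF := ω.fh_lt h
  have hlen : ω.2.arcs.length = ω.2.firstHitG + ω.Mv := len_eq h
  by_contra hA
  have hodd := (ω.AJ_root_ne_zero_iff_odd_rayCountAt (hr := hr) h (b := holeFaceW w) (τ := .E)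
    (holeFaceW_side_E w)).1 hA
  have hpos := hodd.pos
  unfold ΩG.rayCountAt at hpos
  obtain ⟨j, hj⟩ := Finset.card_pos.1 hpos
  rw [Finset.mem_filter, Finset.mem_range] at hj
  obtain ⟨hj, m, hm⟩ := hj
  rw [rayMid_holeFaceW_E_eq] at hm
  -- the crossed ray edge is alive: both faces present
  have hnth : ω.2.nth (ω.2.firstHitG + j + 1) = MidEdge.slant (w.1 + m) w.2 := by
    rw [← side_jOut (hr := hr) h hj]; exact hm
  have hlt : ω.2.firstHitG + j + 1 < ω.2.arcs.length := by
    rcases Nat.lt_or_ge (ω.2.firstHitG + j + 1) ω.2.arcs.length with hl | hl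
    · exact hl
    · exfalso
      have e : ω.2.firstHitG + j + 1 = ω.2.arcs.length := by omega
      rw [e, ω.2.nth_length] at hnth
      exact farW_side_ne_slant_east w ω.1 m hnth
  have hd := ω.2.door_nth (j := ω.2.firstHitG + j + 1) (by omega) hlt
  rw [hnth] at hd
  simp only [MidEdge.faces] at hd
  have hx : (w.1 + m : ℤ) = x₁ := by
    by_contra hne
    rcases Nat.eq_zero_or_pos m with hm0 | hm0
    · subst hm0
      apply hRS
      have ers : rootS w = (w.1 + ((0 : ℕ) : ℤ), w.2 - 1) := by
        obtain ⟨a, b⟩ := w; simp [rootS]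
      rw [ers]; exact hd.1
    · rcases hray (w.1 + m) (by omega) hne with hx | hx
      · exact hx hd.2
      · exact hx hd.1
  refine false_of_under_excursion_ray_oneLiveColumn hh hr h hS hRS hx₁ (fun x hxl hxr => hray x hxl (by omega)) ⟨j, hj, ?_⟩
  rw [hm, hx]

/-- ★★★★★ **`rootS` ABSENT AND AT MOST ONE LIVE RAY COLUMN ⇒ NO WOUND UNDER-WALK** (either orientation of the winding witness).
Hole and `rootS w` absent; for some column `x₁ ≥ w.1 + 1`, every other column `x ≥ w.1 + 1` of the root row's bottom line is
dead (`(x, w.2) ∉ D ∨ (x, w.2 − 1) ∉ D`). Then every class-`B2a` under-walk at the far cell is unwound. With no live column at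
all this is `ΩG.WE_eq_excursionWinding_of_under_rootS_east` (take `x₁ = w.1 + 1`).
[cite: GlazmanManolescu2019, Lemma 2.1 (statement, "in the form given in [Gl]"), §1 (Fig. 2)]
[cite: Glazman2015WeightedSAW, Lemma 3.1 (proof, pp. 6–7)] [cite: CourantRobbins1958, Ch. V Appendix §2 (the even–odd rule)] -/
theorem WE_eq_excursionWinding_of_under_rootS_oneLiveColumn (hh : holeFaceW w ∉ D) (hRS : rootS w ∉ D) {x₁ : ℤ}
    (hx₁ : w.1 + 1 ≤ x₁) (hray : ∀ x : ℤ, w.1 + 1 ≤ x → x ≠ x₁ → (x, w.2) ∉ D ∨ (x, w.2 - 1) ∉ D)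
    (ω : ΩG D (w.side .W) (farW w)) (hr : RootedFace D (w.side .W) (farW w)) (h : ω.IsB2a)
    (hS : ω.2.firstSideG = .S) (θ : ℝ) :
    ω.WE (fun _ => θ) = excursionWinding θ ω.2.firstSideG (ω.z1 hr h) ω.1 := by
  by_contra hW
  rcases ω.AJ_ne_zero_or_rev_of_wound hr h θ hW with hA | hA
  · exact hA (AJ_root_eq_zero_of_under_rootS_oneLiveColumn hh hRS hx₁ hray ω hr h hS)
  · have h' := ω.rev_isB2a hr h
    have hS' : (ω.rev hr).2.firstSideG = .S := by rw [ω.rev_firstSide hr h]; exact hS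
    exact hA (AJ_root_eq_zero_of_under_rootS_oneLiveColumn hh hRS hx₁ hray (ω.rev hr) hr h' hS')

/-- The reflection in the root row on a cell, in coordinates. [cite: GlazmanManolescu2019, §4.2 (lattice symmetries)] -/
private theorem mirrorRowFace_mkL (w : Face) (x y : ℤ) : mirrorRowFace w.2 ((x, y) : Face) = (x, 2 * w.2 - y) := by
  simp [mirrorRowFace]

/-- ★★★★★ **`rootN` ABSENT AND AT MOST ONE LIVE COLUMN ON THE TOP LINE ⇒ NO WOUND OVER-WALK** (row-mirror twin: hole and
`rootN w` absent, `(x, w.2) ∉ D ∨ (x, w.2 + 1) ∉ D` for every `x ≥ w.1 + 1` other than `x₁`).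
[cite: GlazmanManolescu2019, §1 (Fig. 1, Fig. 2), §4.2 (lattice symmetries), Lemma 2.1]
[cite: Glazman2015WeightedSAW, Lemma 3.1 (proof, pp. 6–7)] [cite: CourantRobbins1958, Ch. V Appendix §2 (the even–odd rule)] -/
theorem WE_eq_excursionWinding_of_over_rootN_oneLiveColumn (hh : holeFaceW w ∉ D) (hRN : rootN w ∉ D) {x₁ : ℤ}
    (hx₁ : w.1 + 1 ≤ x₁) (hray : ∀ x : ℤ, w.1 + 1 ≤ x → x ≠ x₁ → (x, w.2) ∉ D ∨ (x, w.2 + 1) ∉ D)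
    (ω : ΩG D (w.side .W) (farW w)) (hr : RootedFace D (w.side .W) (farW w)) (h : ω.IsB2a)
    (hN : ω.2.firstSideG = .N) (θ : ℝ) :
    ω.WE (fun _ => θ) = excursionWinding θ ω.2.firstSideG (ω.z1 hr h) ω.1 := by
  by_contra hW
  have hr' := rootedFace_rowMirrorDom w hr
  have h' := ω.mirrorFar_isB2a hr h
  have hh' : holeFaceW w ∉ rowMirrorDom w D := by rwa [mem_rowMirrorDom, mirrorRowFace_holeFaceW]
  have hRS' : rootS w ∉ rowMirrorDom w D := by rwa [mem_rowMirrorDom, mirrorRowFace_rootS]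
  have hray' : ∀ x : ℤ, w.1 + 1 ≤ x → x ≠ x₁ → (x, w.2) ∉ rowMirrorDom w D ∨ (x, w.2 - 1) ∉ rowMirrorDom w D := by
    intro x hx hne
    rw [mem_rowMirrorDom, mem_rowMirrorDom, mirrorRowFace_row, mirrorRowFace_row_pred]
    exact hray x hx hne
  have hS' : ω.mirrorFar.2.firstSideG = .S := by rw [mirrorFar_firstSideG, hN]; rfl
  exact absurd (WE_eq_excursionWinding_of_under_rootS_oneLiveColumn hh' hRS' hx₁ hray' ω.mirrorFar hr' h' hS' _)
    (ω.mirrorFar_wound hr h hW)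

end ΩG

end Literature.Probability.RandomPlanarGeometry.SAW.YangBaxter

namespace Literature.Barriers.CriticalPhenomena.PlaquetteWalk

open Literature.Probability.RandomPlanarGeometry.SAW.YangBaxter
open Real Complex

/-! ## §3 Boxes: the root plaquette's eastern neighbour in the second-to-last column -/

section Boxes

variable {m n : ℕ} {S : List Face} {h : Face}

/-- ★★★★★ **ALL BOXES: `rootE` IN THE SECOND-TO-LAST COLUMN (`h.1 + 4 = m`), `rootS` REMOVED AND THE RAY'S FIRST COLUMN KILLED
(`rootE = (h.1 + 2, h.2)` or `pocketSE = (h.1 + 2, h.2 − 1)` removed) ⇒ NO WOUND UNDER-WALK**, whatever else `S ∋ h` removes (far cell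
kept): the only live ray column is the last one, `x₁ = h.1 + 3`. (Kit j300087 of the lane: `{rootE, rootS}` and `{pocketSE, rootS}`
under witnesses TIMEOUT in the 7-column frame — decided: none.)
[cite: GlazmanManolescu2019, Lemma 2.1 (statement, "in the form given in [Gl]"), §2.1]
[cite: Glazman2015WeightedSAW, Lemma 3.1 (proof, pp. 6–7)] [cite: CourantRobbins1958, Ch. V Appendix §2 (the even–odd rule)] -/
theorem lawL_box_rootS_rootEcol_not_wound_under (hW : 1 ≤ h.1) (hE4 : h.1 + 4 = m) (hS0 : 0 ≤ h.2) (hN : h.2 + 1 ≤ n)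
    (hh : h ∈ S) (hfS : ((h.1 - 1, h.2) : Face) ∉ S) (hcS : ((h.1 + 1, h.2 - 1) : Face) ∈ S)
    (hcE : ((h.1 + 2, h.2) : Face) ∈ S ∨ ((h.1 + 2, h.2 - 1) : Face) ∈ S)
    (ω : ΩG (dom (boxMinus m n S)) (Face.side (h.1 + 1, h.2) .W) (farW (h.1 + 1, h.2))) (hb : ω.IsB2a)
    (hS' : ω.2.firstSideG = .S) (θ : ℝ) :
    ω.WE (fun _ => θ) = excursionWinding θ ω.2.firstSideG
      (ω.z1 (rootedFace_hroot_boxMinus_of_mem (farW_hroot_mem_boxMinus_of_not_mem hW (by omega) hS0 hN hfS) hh) hb)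
      ω.1 := by
  refine ΩG.WE_eq_excursionWinding_of_under_rootS_oneLiveColumn (x₁ := h.1 + 3) ?_ ?_ (by simp only; omega)
    (fun x hx hne => ?_) ω _ hb hS' θ
  · rw [holeFaceW_hroot]; exact not_mem_dom_boxMinus_of_mem hh
  · have e : rootS ((h.1 + 1, h.2) : Face) = (h.1 + 1, h.2 - 1) := Prod.ext (by simp only [rootS]) rfl
    rw [e]; exact not_mem_dom_boxMinus_of_mem hcS
  · simp only at hx hne ⊢
    rcases lt_or_gt_of_ne hne with hl | hg
    · have ex : x = h.1 + 2 := by omega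
      subst ex
      rcases hcE with hc | hc
      · exact Or.inl (not_mem_dom_boxMinus_of_mem hc)
      · exact Or.inr (not_mem_dom_boxMinus_of_mem hc)
    · left
      intro hm
      obtain ⟨hb', -⟩ := mem_dom_boxMinus.1 hm
      simp only at hb'
      omega

/-- ★★★★★ **TWIN: `h.1 + 4 = m`, `rootN` removed and `rootE` or `pocketNE = (h.1 + 2, h.2 + 1)` removed ⇒ NO WOUND OVER-WALK.**
[cite: GlazmanManolescu2019, Lemma 2.1 (statement, "in the form given in [Gl]"), §2.1, §4.2]
[cite: Glazman2015WeightedSAW, Lemma 3.1 (proof, pp. 6–7)] [cite: CourantRobbins1958, Ch. V Appendix §2 (the even–odd rule)] -/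
theorem lawL_box_rootN_rootEcol_not_wound_over (hW : 1 ≤ h.1) (hE4 : h.1 + 4 = m) (hS0 : 0 ≤ h.2) (hN : h.2 + 1 ≤ n)
    (hh : h ∈ S) (hfS : ((h.1 - 1, h.2) : Face) ∉ S) (hcN : ((h.1 + 1, h.2 + 1) : Face) ∈ S)
    (hcE : ((h.1 + 2, h.2) : Face) ∈ S ∨ ((h.1 + 2, h.2 + 1) : Face) ∈ S)
    (ω : ΩG (dom (boxMinus m n S)) (Face.side (h.1 + 1, h.2) .W) (farW (h.1 + 1, h.2))) (hb : ω.IsB2a)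
    (hN' : ω.2.firstSideG = .N) (θ : ℝ) :
    ω.WE (fun _ => θ) = excursionWinding θ ω.2.firstSideG
      (ω.z1 (rootedFace_hroot_boxMinus_of_mem (farW_hroot_mem_boxMinus_of_not_mem hW (by omega) hS0 hN hfS) hh) hb)
      ω.1 := by
  refine ΩG.WE_eq_excursionWinding_of_over_rootN_oneLiveColumn (x₁ := h.1 + 3) ?_ ?_ (by simp only; omega)
    (fun x hx hne => ?_) ω _ hb hN' θ
  · rw [holeFaceW_hroot]; exact not_mem_dom_boxMinus_of_mem hh
  · have e : rootN ((h.1 + 1, h.2) : Face) = (h.1 + 1, h.2 + 1) := Prod.ext (by simp only [rootN]) rfl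
    rw [e]; exact not_mem_dom_boxMinus_of_mem hcN
  · simp only at hx hne ⊢
    rcases lt_or_gt_of_ne hne with hl | hg
    · have ex : x = h.1 + 2 := by omega
      subst ex
      rcases hcE with hc | hc
      · exact Or.inl (not_mem_dom_boxMinus_of_mem hc)
      · exact Or.inr (not_mem_dom_boxMinus_of_mem hc)
    · left
      intro hm
      obtain ⟨hb', -⟩ := mem_dom_boxMinus.1 hm
      simp only at hb'
      omega

end Boxes

end Literature.Barriers.CriticalPhenomena.PlaquetteWalk
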